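import Summits.BirchSwinnertonDyer.BirchSwinnertonDyer.Theorems.SignedLowerHalvesKobayashiMainConjectureSmallImageMuSaturation
import Summits.BirchSwinnertonDyer.BirchSwinnertonDyer.Theorems.SignedLowerHalvesKobayashiMainConjectureSmallImageCMTransferRecordsA
import Summits.BirchSwinnertonDyer.Rank1Residual.Partition.MainConjecturesCMSupersingular
import Literature.NumberTheory.EllipticCurves.BDKim2009.SignedSelmerCongruentMuInvariant
import Literature.NumberTheory.EllipticCurves.Rank1Residual.Typed.X7
import HarnessLib

/-!
# Route `SignedLowerHalves`, crux `KobayashiMainConjectureSmallImage` (item stmt-BirchSwinnertonDyer-19002):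
# the `μ`-SATURATION, part 2 — `μ(X^ε(E)) = 0` TRANSFERS from a CM partner by B. D. Kim 2009 Cor. 2.13
# (PUBLISHED), so the CM-congruence transfer line needs NO preprint in analytic rank `0`, and the
# saturation stub holds on CM-partnered pairs in EVERY rank
# (cell `bsd-ssimc`, seat `bsd-ssimc-k3-c4` gen 4; helper file, `--supports … --as helper`)

HONEST FRAMING: Kobayashi's signed main conjecture at a non-surjective (normaliser-of-non-split-Cartan)
image is OPEN; nothing here proves it for the class. This file proves CONDITIONAL theorems whose
non-published inputs are DISPLAYED binders: per curve a CM partner with a `Γ_ℚ`-equivariant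
`E[p] ≃ E'[p]` and `μ(L_p^±(E')) = 0` (a two-engine certificate, or a THEOREM in the unit case from
one `L`-value certificate) and, in rank `0`, `BSD(E,p)` (settled per pair in the tree by exact
descent); everything else is a PUBLISHED named fact consumed BY NAME — B. D. Kim 2009 Cor. 2.13
(`BDKim2009.cor213_signedMu_eq_zero_iff_of_torsionIso`), Pollack–Rubin 2004, Kobayashi 2003 Thm. 1.2 /
Thm. 4.1 (rational clause), B. D. Kim 2013 Cor. 3.15, Pollack 2003, modularity, GZK, the period-unit
facts. NO preprint binder (`CorpuzLei2025_…_OPEN`) occurs in this file. Item 4 stays OPEN; nothing is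
booked; BSD is not proved by any of this.

PARTITION (cell bsd-ssimc): X7 (A7) × the CM-EC-partnered non-surjective `a_p = 0` pairs (79 of the
136 window pairs; 76 of analytic rank 0) — types-the-object-of; closes NONE.

## Why the preprint is not load-bearing in rank 0

The line of record L4-CM (`CorpuzLei2025_signedMainConjecture_transfer_OPEN.lean` + 79 per-pair
records) reaches `KobayashiMainConjecture W p ε` from a CM partner modulo ONE PRE binder (Corpuz–Lei
arXiv:2508.09733, Thms 1+2+3: analytic `μ`-transfer, algebraic `μ`-transfer, IMC transfer). The
ALGEBRAIC third is in print since 2009 — B. D. Kim, Asian J. Math. 13, Cor. 2.13: for `E[p] ≅ E'[p]`,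
both good supersingular with `a_p = 0`, `μ(X^±(E)) = 0 ⟺ μ(X^±(E')) = 0` — and by part 1
(`…SmallImageMuSaturation.lean`) `μ(X^ε(E)) = 0` is all the rank-`0` converse needs beyond
`BSD(E,p)`, which the tree settles per pair by exact descent (`bsdp3_nn<label>` / `bsdp_s<label>`).

* §4 `mu_eq_zero_of_cmPartner` — B. D. Kim 2009 + Pollack–Rubin + the partner's `μ(L_p^±(E')) = 0`
  ⟹ `μ(X^ε(E/ℚ_∞)) = 0` for every sign and every dual datum.
* §5 the class theorems of the line WITHOUT the preprint:
  `kobayashiMainConjecture_of_cmPartner_of_bsdp_of_analyticRank_eq_zero` (rank 0, + `BSD(E,p)`; both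
  signs), `…_of_lvalue_of_bsdp_…` (the partner's unit case: one `L`-value certificate),
  `kobayashiMainConjecture_iff_bsdp_of_cmPartner_of_analyticRank_eq_zero` (on that locus Kobayashi's
  conjecture for either sign ⟺ `BSD(E,p)` — the small-image analogue of the b2b equivalence at
  surjective image), `kobayashiMainConjecture_of_cmPartner_of_lowerDivisibility` (saturation, ANY
  rank), and `stub_saturationSmallImage_of_cmPartner` — the registered stub `stub_saturationSmallImage`
  header VERBATIM with the published facts + the partner data as the only extra binders.

What is NOT here: `stub_lowerSmallImage` (the Eisenstein half at small image — no engine in print;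
the crux stays OPEN); anything for the 57 window pairs without a CM elliptic-curve partner; rank 1
beyond saturation (BKO Cor. A.5 needs the equality, which in rank 1 still needs the lower half); the
per-pair records (separate files); anything booked.

References: [BDKim2009] Cor. 2.13; [Kobayashi2003] Thm. 1.2, Thm. 4.1, Conjecture (p. 2);
[PollackRubin2004] Thm. (p. 448); [BDKim2013] Cor. 3.15; [Pollack2003] Prop. 6.18;
[GreenbergVatsal2000] p. 2 (1)–(2), §3 Rem. 3.4; [Kurihara2002] Thm. 0.1 (unit case);
[Miller2011LMS] Def. 1.1.
-/

set_option autoImplicit false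
set_option linter.dupNamespace false

noncomputable section

open scoped Classical MatrixGroups ModularForm

open CongruenceSubgroup WeierstrassCurve Literature.NumberTheory.EllipticCurves
  Literature.NumberTheory.EllipticCurves.ModularForms
  Literature.NumberTheory.EllipticCurves.Rank1Residual
  Literature.NumberTheory.EllipticCurves.Rank1Residual.Typed
  Literature.NumberTheory.EllipticCurves.Kobayashi2003 ZpExtension
  Literature.NumberTheory.EllipticCurves.GreenbergVatsal2000
  Literature.NumberTheory.EllipticCurves.BDKim2009
  Summit.BirchSwinnertonDyer.Rank1Residual.Supersingular
  Summit.BirchSwinnertonDyer.Rank1Residual.X1.MuLambda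

namespace Summit.BirchSwinnertonDyer.BirchSwinnertonDyer.Theorems

/-! ### §4 `μ(X^ε(E)) = 0` from a CM partner: B. D. Kim 2009 + Pollack–Rubin + the partner's `μ = 0` -/

section Partner

variable (W W' : WeierstrassCurve ℚ) [W.IsElliptic] [W.IsGloballyMinimal] [W'.IsElliptic]
  [W'.IsGloballyMinimal] (p : ℕ) [Fact p.Prime]

/-- **The CM partner supplies `μ(X^ε(E/ℚ_∞)) = 0`, every sign, every datum — PUBLISHED inputs only.**
Let `p` be an odd prime of good reduction of `E = W` with `a_p = 0` (ANY image), and `E' = W'` a CM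
curve (`W'.HasCM`) with good supersingular reduction at `p`, `a_p(E') = 0`, a `Γ_ℚ`-equivariant
`E[p] ≃ E'[p]` (`hiso`) and `μ(L_p^±(E')) = 0` (`hμ'`: unit content of Kobayashi's `L^ε` for every
Pollack pair of the newform of `E'` — per partner a two-engine certificate, or a THEOREM in the unit
case, `hasUnitContent_kobayashiL_of_lvalue`). Granted BY NAME B. D. Kim 2009 Cor. 2.13 (`h09`),
Pollack–Rubin 2004 (`hPR`), Kobayashi Thm. 1.2 (`h12`), the period-unit facts (`h5`, `h3`), Pollack
2003 (`hPollack`, existence of the pair) and modularity (`hmod`, the newform of `E'` with its period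
ratio): `μ(X^ε(E/ℚ_∞)) = 0`. Chain: Pollack–Rubin gives `char X^ε(E') = (g')`, `ι g' = ϖ'·ι L^ε(E')`
with `ϖ' ∈ ℤ_p^×`, so `g'` has unit content iff `L^ε(E')` does (`hμ'`); hence `μ(X^ε(E')) = 0`
(Greenberg–Vatsal (2)); hence `μ(X^ε(E)) = 0` (Kim Cor. 2.13). CONDITIONAL on the displayed binders.
[cite: BDKim2009, Cor. 2.13 (p. 187)] [cite: PollackRubin2004, Theorem (p. 448) = Thm. 7.3]
[cite: Kobayashi2003, Thm. 1.2 (p. 2)] [cite: GreenbergVatsal2000, p. 2 (2) and §3 Remark 3.4]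
[cite: Pollack2003, Prop. 6.18] -/
theorem mu_eq_zero_of_cmPartner (h09 : cor213_signedMu_eq_zero_iff_of_torsionIso)
    (hPR : PollackRubin2004.mainTheorem_signedCharIdeal_eq_of_cm)
    (h12 : Kobayashi2003.thm12_signedSelmerDual_finite_torsion)
    (h5 : realPeriodRat_eq_unit_mul_plusPeriod) (h3 : realPeriodRat_eq_unit_mul_plusPeriod_three)
    (hPollack : ∀ {V : WeierstrassCurve ℚ} [V.IsElliptic] [V.IsGloballyMinimal] {N : ℕ} [NeZero N]
      {g : CuspForm (Gamma0 N) 2} {q : ℕ} [Fact q.Prime],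
      pollack_exists_plusMinusPAdicLFunction (W := V) (f := g) (p := q))
    (hmod : nonempty_modularParametrizationData)
    (hp : p ≠ 2) (hgood : W.HasGoodReductionAtPrime p) (hap : W.frobeniusTrace p = 0)
    (hcm' : W'.HasCM) (hss' : GoodSS W' p) (hap' : W'.frobeniusTrace p = 0)
    (hiso : ∃ e : geomTorsion W (p : ℤ) ≃+ geomTorsion W' (p : ℤ),
      ∀ (σ : Field.absoluteGaloisGroup ℚ) (P : geomTorsion W (p : ℤ)), e (σ • P) = σ • e P)
    (hμ' : ∀ [NeZero (W'.conductorNorm ℤ)] (f' : CuspForm (Gamma0 (W'.conductorNorm ℤ)) 2),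
      IsNewformOf W' f' → ∀ (Lplus Lminus : IwasawaAlgebra p), IsPollackPair f' p Lplus Lminus →
      ∀ ε : ℤˣ, HasUnitContent (kobayashiL ε Lplus Lminus))
    {κ : ZpExtension ℚ p} {γ : Field.absoluteGaloisGroup ℚ} (hκ : κ.IsCyclotomic)
    (hγ : κ.IsTopGenerator γ) (hγ' : IsCyclotomicVariable p γ) (ε : ℤˣ)
    (D : SignedSelmerDualData W κ γ ε) : D.mu = 0 := by
  -- modularity for `E'`: the newform `f'` and a rational period ratio `ϖ'`; a Pollack pair; a datum
  haveI : NeZero (W'.conductorNorm ℤ) := ⟨(W'.conductorNorm_pos_holds).ne'⟩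
  obtain ⟨Dm⟩ := hmod W'
  set f' := Dm.f with hf'_def
  have hf' : IsNewformOf W' f' := Dm.isNewformOf
  obtain ⟨ϖ', -, hϖeq, -⟩ := Dm.exists_rat_mul_realPeriodRat_eq_plusPeriod
  obtain ⟨Lplus, Lminus, hPP'⟩ := exists_isPollackPair hPollack hp hf' hss'.1 hap'
  obtain ⟨D'⟩ := nonempty_signedSelmerDualData W' κ ε hγ
  -- Pollack–Rubin: `char X^ε(E') = (g')`, `ι g' = ϖ' · ι L^ε(E')`
  obtain ⟨hX', g', hg', hι'⟩ :=
    kobayashiMainConjecture_of_pollackRubin_of_goodSS W' p hPR hcm' hp hss' ε κ γ hκ hγ hγ' f' hf' ϖ'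
      hϖeq Lplus Lminus hPP' D'
  -- `ϖ'` is a `p`-adic unit, so `g' = C(u) · L^ε(E')` has unit content by `hμ'`
  have hirr' : W'.HasIrreducibleModPGaloisRep p :=
    hasIrreducibleModPGaloisRep_of_dvd_frobeniusTrace W' p hp
      (W'.not_dvd_minimalDiscriminantInt_of_hasGoodReductionAtPrime' p hss'.1) hss'.2
  have hvϖ : padicValRat p ϖ' = 0 :=
    padicValRat_periodRatio_eq_zero h5 h3 W' p hp hss'.1 hirr' f' hf' ϖ' hϖeq
  have hϖ0 : ϖ' ≠ 0 := by
    intro hz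
    rw [hz, Rat.cast_zero, zero_mul] at hϖeq
    exact (IsNewform0.plusPeriod_pos_holds hf'.1 hf'.coeffField_eq_bot).ne' hϖeq.symm
  obtain ⟨u, hu⟩ := exists_units_coe_eq_ratCast hϖ0 hvϖ
  obtain ⟨-, hιu⟩ := span_C_units_mul_eq u (kobayashiL ε Lplus Lminus)
  have hgeq : g' = PowerSeries.C (u : ℤ_[p]) * kobayashiL ε Lplus Lminus :=
    iwasawaToPowerSeries_injective p (by rw [hι', hιu, hu])
  have hug' : HasUnitContent g' := by
    rw [hgeq, hasUnitContent_unit_mul_iff ((Units.isUnit u).map PowerSeries.C)]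
    exact hμ' f' hf' Lplus Lminus hPP' ε
  -- `μ(X^ε(E')) = 0` (Greenberg–Vatsal (2)) and the transfer (B. D. Kim 2009 Cor. 2.13)
  haveI : Module.Finite (IwasawaAlgebra p) D.X := h12.moduleFinite hp hgood hap hκ hγ D
  haveI : Module.Finite (IwasawaAlgebra p) D'.X := h12.moduleFinite hp hss'.1 hap' hκ hγ D'
  have hX : Module.IsTorsion (IwasawaAlgebra p) D.X := h12.isTorsion hp hgood hap hκ hγ D
  have hμD' : D'.mu = 0 := (muInvariant_eq_zero_iff_hasUnitContent D'.X hX' hg').mpr hug'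
  exact (h09 W W' p hp hgood hap hss'.1 hap' hiso κ γ hκ hγ ε D D' hX hX').mpr hμD'

end Partner

/-! ### §5 The class theorems of the line WITHOUT the preprint -/

section ClassTheorems

variable (W W' : WeierstrassCurve ℚ) [W.IsElliptic] [W.IsGloballyMinimal] [W'.IsElliptic]
  [W'.IsGloballyMinimal] (p : ℕ) [Fact p.Prime]

/-- **The CM-congruence transfer in rank `0`, PUBLISHED inputs + `BSD(E,p)` — NO preprint binder.**
`E = W` with `p` odd good, `a_p = 0` (ANY image), `ord_{s=1} L(E,s) = 0` and `BSDp W p` (settled per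
pair in the tree, e.g. by the exact-descent theorems `bsdp3_nn<label>` / `bsdp_s<label>`); a CM
partner `E' = W'` (good supersingular at `p`, `a_p(E') = 0`, `E[p] ≃ E'[p]` `Γ_ℚ`-equivariantly,
`hiso`) with `μ(L_p^±(E')) = 0` (`hμ'`). Granted BY NAME B. D. Kim 2009 Cor. 2.13 (`h09`),
Pollack–Rubin 2004 (`hPR`), Kobayashi 2003 Thm. 1.2 (`h12`) and Thm. 4.1 (`h41`, rational clause),
B. D. Kim 2013 Cor. 3.15 (`hKim`), the period-unit facts (`h5`, `h3`), Pollack 2003 (`hPollack`),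
modularity (`hmod`, `hmod'`) and GZK (`hGZK`): `KobayashiMainConjecture W p ε` for EVERY sign `ε`
(§4 ⟹ `μ(X^ε(E)) = 0` ⟹ §2). Compare `kobayashiMainConjecture_of_cmPartner_of_transfer_OPEN`
(the same conclusion modulo the Corpuz–Lei PRE binder and without `BSD(E,p)`): in rank `0` the
preprint is traded for the pair's own `p`-part of BSD. CONDITIONAL on the displayed binders; per
pair; closes nothing. [cite: BDKim2009, Cor. 2.13 (p. 187)] [cite: PollackRubin2004, Theorem (p. 448) = Thm. 7.3]
[cite: Kobayashi2003, Thm. 1.2, Thm. 4.1 and Conjecture (p. 2)] [cite: BDKim2013, Cor. 3.15 (p. 199)]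
[cite: Miller2011LMS, Def. 1.1] -/
theorem kobayashiMainConjecture_of_cmPartner_of_bsdp_of_analyticRank_eq_zero
    (h09 : cor213_signedMu_eq_zero_iff_of_torsionIso)
    (hPR : PollackRubin2004.mainTheorem_signedCharIdeal_eq_of_cm)
    (h12 : Kobayashi2003.thm12_signedSelmerDual_finite_torsion)
    (h41 : Kobayashi2003.thm41_signedCharIdeal_divisibility)
    (hKim : BDKim2013.cor315_signedCharValue_rankZero)
    (h5 : realPeriodRat_eq_unit_mul_plusPeriod) (h3 : realPeriodRat_eq_unit_mul_plusPeriod_three)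
    (hPollack : ∀ {V : WeierstrassCurve ℚ} [V.IsElliptic] [V.IsGloballyMinimal] {N : ℕ} [NeZero N]
      {g : CuspForm (Gamma0 N) 2} {q : ℕ} [Fact q.Prime],
      pollack_exists_plusMinusPAdicLFunction (W := V) (f := g) (p := q))
    (hmod : nonempty_modularParametrizationData) (hmod' : hasEntireLFunction_rat)
    (hGZK : rank_eq_analyticRank_of_analyticRank_le_one)
    (hp : p ≠ 2) (hgood : W.HasGoodReductionAtPrime p) (hap : W.frobeniusTrace p = 0)
    (hcm' : W'.HasCM) (hss' : GoodSS W' p) (hap' : W'.frobeniusTrace p = 0)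
    (hiso : ∃ e : geomTorsion W (p : ℤ) ≃+ geomTorsion W' (p : ℤ),
      ∀ (σ : Field.absoluteGaloisGroup ℚ) (P : geomTorsion W (p : ℤ)), e (σ • P) = σ • e P)
    (hμ' : ∀ [NeZero (W'.conductorNorm ℤ)] (f' : CuspForm (Gamma0 (W'.conductorNorm ℤ)) 2),
      IsNewformOf W' f' → ∀ (Lplus Lminus : IwasawaAlgebra p), IsPollackPair f' p Lplus Lminus →
      ∀ ε : ℤˣ, HasUnitContent (kobayashiL ε Lplus Lminus))
    (h0 : W.analyticRank = 0) (hB : BSDp W p) (ε : ℤˣ) : KobayashiMainConjecture W p ε :=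
  kobayashiMainConjecture_of_mu_eq_zero_of_bsdp_of_analyticRank_eq_zero W p h12 h41 hKim h5 h3 hGZK
    hmod' hp hgood hap
    (fun _κ _γ hκ hγ hγ' D ↦ mu_eq_zero_of_cmPartner W W' p h09 hPR h12 h5 h3 hPollack hmod hp hgood
      hap hcm' hss' hap' hiso hμ' hκ hγ hγ' ε D)
    h0 hB

/-- **Rank `0`, UNIT CASE of the partner — everything published except ONE `L`-value certificate and
`BSD(E,p)`.** As `kobayashiMainConjecture_of_cmPartner_of_bsdp_of_analyticRank_eq_zero`, with the
partner's `μ(L_p^±(E')) = 0` DISCHARGED in the kernel from the certificate `L(E',1)/Ω(E') = q`,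
`q ≠ 0`, `ord_p q = 0` (`hasUnitContent_kobayashiL_of_lvalue`: Kurihara's unit case — a THEOREM, no
`μ`-certificate). CONDITIONAL on the displayed binders; per pair; closes nothing.
[cite: BDKim2009, Cor. 2.13 (p. 187)] [cite: Kurihara2002, Thm. 0.1]
[cite: PollackRubin2004, Theorem (p. 448) = Thm. 7.3] [cite: Kobayashi2003, Conjecture (Main Conjecture) (p. 2)] -/
theorem kobayashiMainConjecture_of_cmPartner_of_lvalue_of_bsdp_of_analyticRank_eq_zero
    (h09 : cor213_signedMu_eq_zero_iff_of_torsionIso)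
    (hPR : PollackRubin2004.mainTheorem_signedCharIdeal_eq_of_cm)
    (h12 : Kobayashi2003.thm12_signedSelmerDual_finite_torsion)
    (h41 : Kobayashi2003.thm41_signedCharIdeal_divisibility)
    (hKim : BDKim2013.cor315_signedCharValue_rankZero)
    (h5 : realPeriodRat_eq_unit_mul_plusPeriod) (h3 : realPeriodRat_eq_unit_mul_plusPeriod_three)
    (hPollack : ∀ {V : WeierstrassCurve ℚ} [V.IsElliptic] [V.IsGloballyMinimal] {N : ℕ} [NeZero N]
      {g : CuspForm (Gamma0 N) 2} {q : ℕ} [Fact q.Prime],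
      pollack_exists_plusMinusPAdicLFunction (W := V) (f := g) (p := q))
    (hmod : nonempty_modularParametrizationData) (hmod' : hasEntireLFunction_rat)
    (hGZK : rank_eq_analyticRank_of_analyticRank_le_one)
    (hp : p ≠ 2) (hgood : W.HasGoodReductionAtPrime p) (hap : W.frobeniusTrace p = 0)
    (hcm' : W'.HasCM) (hgood' : W'.HasGoodReductionAtPrime p) (hap' : W'.frobeniusTrace p = 0)
    (hiso : ∃ e : geomTorsion W (p : ℤ) ≃+ geomTorsion W' (p : ℤ),
      ∀ (σ : Field.absoluteGaloisGroup ℚ) (P : geomTorsion W (p : ℤ)), e (σ • P) = σ • e P)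
    {q : ℚ} (hq0 : q ≠ 0) (hL' : W'.entireLFunction 1 / (W'.realPeriodRat : ℂ) = (q : ℂ))
    (hv : padicValRat p q = 0)
    (h0 : W.analyticRank = 0) (hB : BSDp W p) (ε : ℤˣ) : KobayashiMainConjecture W p ε :=
  kobayashiMainConjecture_of_cmPartner_of_bsdp_of_analyticRank_eq_zero W W' p h09 hPR h12 h41 hKim h5
    h3 hPollack hmod hmod' hGZK hp hgood hap hcm' ⟨hgood', by rw [hap']; exact dvd_zero _⟩ hap' hiso
    (hasUnitContent_kobayashiL_of_lvalue W' p h5 h3 hp hgood' hap' hq0 hL' hv) h0 hB ε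

/-- **On the CM-partnered rank-`0` locus Kobayashi's main conjecture (either sign) is EQUIVALENT to
`BSD(E,p)`** — PUBLISHED inputs + the partner certificate only. Forward: the tree's image-free
`bsdp_of_kobayashiMainConjecture_of_analyticRank_eq_zero` (Kim + Pollack + GZK + modularity; `E[p]`
irreducible as `a_p = 0`); backward: `kobayashiMainConjecture_of_cmPartner_of_bsdp_…`. This is the
small-image analogue of the b2b equivalence at surjective image
(`Supersingular.kobayashiMainConjecture_of_bsdp_…` / `bsdp_of_kobayashiMainConjecture_…`), with the
`μ`-transfer from the CM partner in place of Serre/Kato surjectivity. CONDITIONAL on the displayed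
binders; closes nothing. [cite: BDKim2009, Cor. 2.13 (p. 187)] [cite: Kobayashi2003, Thm. 4.1 (p. 8) and Conjecture (p. 2)]
[cite: BDKim2013, Cor. 3.15 (p. 199)] [cite: Miller2011LMS, Def. 1.1] -/
theorem kobayashiMainConjecture_iff_bsdp_of_cmPartner_of_analyticRank_eq_zero
    (h09 : cor213_signedMu_eq_zero_iff_of_torsionIso)
    (hPR : PollackRubin2004.mainTheorem_signedCharIdeal_eq_of_cm)
    (h12 : Kobayashi2003.thm12_signedSelmerDual_finite_torsion)
    (h41 : Kobayashi2003.thm41_signedCharIdeal_divisibility)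
    (hKim : BDKim2013.cor315_signedCharValue_rankZero)
    (h5 : realPeriodRat_eq_unit_mul_plusPeriod) (h3 : realPeriodRat_eq_unit_mul_plusPeriod_three)
    (hPollack : ∀ {V : WeierstrassCurve ℚ} [V.IsElliptic] [V.IsGloballyMinimal] {N : ℕ} [NeZero N]
      {g : CuspForm (Gamma0 N) 2} {q : ℕ} [Fact q.Prime],
      pollack_exists_plusMinusPAdicLFunction (W := V) (f := g) (p := q))
    (hmod : nonempty_modularParametrizationData) (hmod' : hasEntireLFunction_rat)
    (hGZK : rank_eq_analyticRank_of_analyticRank_le_one)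
    (hp : p ≠ 2) (hgood : W.HasGoodReductionAtPrime p) (hap : W.frobeniusTrace p = 0)
    (hcm' : W'.HasCM) (hss' : GoodSS W' p) (hap' : W'.frobeniusTrace p = 0)
    (hiso : ∃ e : geomTorsion W (p : ℤ) ≃+ geomTorsion W' (p : ℤ),
      ∀ (σ : Field.absoluteGaloisGroup ℚ) (P : geomTorsion W (p : ℤ)), e (σ • P) = σ • e P)
    (hμ' : ∀ [NeZero (W'.conductorNorm ℤ)] (f' : CuspForm (Gamma0 (W'.conductorNorm ℤ)) 2),
      IsNewformOf W' f' → ∀ (Lplus Lminus : IwasawaAlgebra p), IsPollackPair f' p Lplus Lminus →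
      ∀ ε : ℤˣ, HasUnitContent (kobayashiL ε Lplus Lminus))
    (h0 : W.analyticRank = 0) (ε : ℤˣ) : KobayashiMainConjecture W p ε ↔ BSDp W p := by
  have hirr : W.HasIrreducibleModPGaloisRep p :=
    hasIrreducibleModPGaloisRep_of_dvd_frobeniusTrace W p hp
      (W.not_dvd_minimalDiscriminantInt_of_hasGoodReductionAtPrime' p hgood) (by rw [hap]; exact dvd_zero _)
  refine ⟨fun hMC ↦ ?_, fun hB ↦ ?_⟩
  · exact bsdp_of_kobayashiMainConjecture_of_analyticRank_eq_zero W p h12 hKim hPollack hmod hmod' hGZK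
      hp hgood hap hirr h0 hMC
  · exact kobayashiMainConjecture_of_cmPartner_of_bsdp_of_analyticRank_eq_zero W W' p h09 hPR h12 h41
      hKim h5 h3 hPollack hmod hmod' hGZK hp hgood hap hcm' hss' hap' hiso hμ' h0 hB ε

/-- **Saturation for CM-partnered pairs, ANY rank — PUBLISHED inputs + the partner certificate.** `E = W`
with `p` odd good, `a_p = 0`; a CM partner as in `mu_eq_zero_of_cmPartner`. Then for EVERY sign the
Eisenstein half `KobayashiLowerDivisibility W p ε` already implies `KobayashiMainConjecture W p ε`
(§4 ⟹ `μ(X^ε(E)) = 0` ⟹ §3). Hence on this sub-class of item 4 the EQUALITY costs exactly the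
LOWER half, also in analytic rank `1` — where MEMO-1 had the saturation stub load-bearing (BKO
Cor. A.5 eats the equality). CONDITIONAL on the displayed binders; closes nothing.
[cite: BDKim2009, Cor. 2.13 (p. 187)] [cite: PollackRubin2004, Theorem (p. 448) = Thm. 7.3]
[cite: Kobayashi2003, Thm. 1.2, Thm. 4.1 and Conjecture (p. 2)] -/
theorem kobayashiMainConjecture_of_cmPartner_of_lowerDivisibility
    (h09 : cor213_signedMu_eq_zero_iff_of_torsionIso)
    (hPR : PollackRubin2004.mainTheorem_signedCharIdeal_eq_of_cm)
    (h12 : Kobayashi2003.thm12_signedSelmerDual_finite_torsion)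
    (h41 : Kobayashi2003.thm41_signedCharIdeal_divisibility)
    (h5 : realPeriodRat_eq_unit_mul_plusPeriod) (h3 : realPeriodRat_eq_unit_mul_plusPeriod_three)
    (hPollack : ∀ {V : WeierstrassCurve ℚ} [V.IsElliptic] [V.IsGloballyMinimal] {N : ℕ} [NeZero N]
      {g : CuspForm (Gamma0 N) 2} {q : ℕ} [Fact q.Prime],
      pollack_exists_plusMinusPAdicLFunction (W := V) (f := g) (p := q))
    (hmod : nonempty_modularParametrizationData)
    (hp : p ≠ 2) (hgood : W.HasGoodReductionAtPrime p) (hap : W.frobeniusTrace p = 0)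
    (hcm' : W'.HasCM) (hss' : GoodSS W' p) (hap' : W'.frobeniusTrace p = 0)
    (hiso : ∃ e : geomTorsion W (p : ℤ) ≃+ geomTorsion W' (p : ℤ),
      ∀ (σ : Field.absoluteGaloisGroup ℚ) (P : geomTorsion W (p : ℤ)), e (σ • P) = σ • e P)
    (hμ' : ∀ [NeZero (W'.conductorNorm ℤ)] (f' : CuspForm (Gamma0 (W'.conductorNorm ℤ)) 2),
      IsNewformOf W' f' → ∀ (Lplus Lminus : IwasawaAlgebra p), IsPollackPair f' p Lplus Lminus →
      ∀ ε : ℤˣ, HasUnitContent (kobayashiL ε Lplus Lminus))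
    {ε : ℤˣ} (hlow : KobayashiLowerDivisibility W p ε) : KobayashiMainConjecture W p ε :=
  kobayashiMainConjecture_of_mu_eq_zero_of_lowerDivisibility W p h12 h41 h5 h3 hp hgood hap
    (fun _κ _γ hκ hγ hγ' D ↦ mu_eq_zero_of_cmPartner W W' p h09 hPR h12 h5 h3 hPollack hmod hp hgood
      hap hcm' hss' hap' hiso hμ' hκ hγ hγ' ε D)
    hlow

end ClassTheorems

/-- **The registered stub `stub_saturationSmallImage` of crux `KobayashiMainConjectureSmallImage`
(BC3 skeleton, header VERBATIM) for CM-PARTNERED pairs — PUBLISHED facts + the partner data as the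
only extra leading binders; NO preprint.** Extra binders: B. D. Kim 2009 Cor. 2.13 (`h09`),
Pollack–Rubin (`hPR`), Kobayashi Thm. 1.2 / Thm. 4.1 (`h12`, `h41`), the period-unit facts (`h5`,
`h3`), Pollack (`hPollack`), modularity (`hmod`), and — per curve — `hpartner`: a CM `W'` good
supersingular at `p` with `a_p(W') = 0`, a `Γ_ℚ`-equivariant `W[p] ≃ W'[p]` and unit content of
`W'`'s `L_p^±`. Then for EVERY sign `lower ⟹ equality` (`kobayashiMainConjecture_of_cmPartner_of_lowerDivisibility`).
The stub's own binders `ClassX7`, `¬CM`, `¬Surj` are carried unused (the argument is image-free).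
Compare `stub_lowerSmallImage_of_cmPartner_of_transfer_OPEN` (the OTHER stub, modulo the PRE binder).
CONDITIONAL; closes nothing. [cite: BDKim2009, Cor. 2.13 (p. 187)]
[cite: PollackRubin2004, Theorem (p. 448) = Thm. 7.3] [cite: Kobayashi2003, Thm. 4.1 (p. 8) and Conjecture (p. 2)] -/
theorem stub_saturationSmallImage_of_cmPartner
    (h09 : cor213_signedMu_eq_zero_iff_of_torsionIso)
    (hPR : PollackRubin2004.mainTheorem_signedCharIdeal_eq_of_cm)
    (h12 : Kobayashi2003.thm12_signedSelmerDual_finite_torsion)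
    (h41 : Kobayashi2003.thm41_signedCharIdeal_divisibility)
    (h5 : realPeriodRat_eq_unit_mul_plusPeriod) (h3 : realPeriodRat_eq_unit_mul_plusPeriod_three)
    (hPollack : ∀ {V : WeierstrassCurve ℚ} [V.IsElliptic] [V.IsGloballyMinimal] {N : ℕ} [NeZero N]
      {g : CuspForm (Gamma0 N) 2} {q : ℕ} [Fact q.Prime],
      pollack_exists_plusMinusPAdicLFunction (W := V) (f := g) (p := q))
    (hmod : nonempty_modularParametrizationData) :
    ∀ (W : WeierstrassCurve ℚ) [W.IsElliptic] [W.IsGloballyMinimal] (p : ℕ) [Fact p.Prime],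
      p ≠ 2 → Literature.NumberTheory.EllipticCurves.Rank1Residual.ClassX7 W p → ¬ W.HasCM →
      W.frobeniusTrace p = 0 → ¬ Literature.NumberTheory.EllipticCurves.Rank1Residual.Surj W p →
      (∃ (W' : WeierstrassCurve ℚ) (_ : W'.IsElliptic) (_ : W'.IsGloballyMinimal),
        W'.HasCM ∧ Literature.NumberTheory.EllipticCurves.Rank1Residual.GoodSS W' p ∧
        W'.frobeniusTrace p = 0 ∧
        (∃ e : geomTorsion W (p : ℤ) ≃+ geomTorsion W' (p : ℤ),
          ∀ (σ : Field.absoluteGaloisGroup ℚ) (P : geomTorsion W (p : ℤ)), e (σ • P) = σ • e P) ∧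
        (∀ [NeZero (W'.conductorNorm ℤ)] (f' : CuspForm (Gamma0 (W'.conductorNorm ℤ)) 2),
          IsNewformOf W' f' → ∀ (Lplus Lminus : IwasawaAlgebra p), IsPollackPair f' p Lplus Lminus →
          ∀ ε : ℤˣ, HasUnitContent (kobayashiL ε Lplus Lminus))) →
      ∀ ε : ℤˣ, Summit.BirchSwinnertonDyer.Rank1Residual.Supersingular.KobayashiLowerDivisibility W p ε →
        Summit.BirchSwinnertonDyer.Rank1Residual.Supersingular.KobayashiMainConjecture W p ε := by
  intro W _ _ p _ hp hX _hcm hap _hs hpartner ε hlow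
  obtain ⟨W', _, _, hcm', hss', hap', hiso, hμ'⟩ := hpartner
  exact kobayashiMainConjecture_of_cmPartner_of_lowerDivisibility W W' p h09 hPR h12 h41 h5 h3 hPollack
    hmod hp hX.1.1 hap hcm' hss' hap' hiso hμ' hlow

end Summit.BirchSwinnertonDyer.BirchSwinnertonDyer.Theorems

end
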